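import Summits.QuantumFields.YangMills.Theorems.BalabanUVNodesN08Constructed
import Summits.QuantumFields.YangMills.Theorems.BalabanUVNodesN08AlphaEq324RowRange

/-!
# Route «BalabanUVNodes», Track-A DAG node N08 = [Balaban1985UV3] Thm 1 p. 257 ∕ Thm 2 p. 272 — N08 BY NAME AT THE C-BINDING OF RECORD OVER THE d = 3
# LANE'S CONSTRUCTED RUN FAMILY, FROM THE RANGE-HONEST CORE (α) CLAUSE `RunAlphaEq324CoreLT` (dag-n08-a's T4 `…N08Constructed` §0–§1 with the (α)
# hypothesis `RunAlpha` REPLACED by the source-faithful ∕ idle-row-free ∕ range-honest clause of `…N08AlphaEq324RowRange`)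

Cell `pub-ymgap`, seat `pub-ymgap-dag-n08-w4` gen 0 (INTENT-6; closes the loop of the (α)-schema lineage `…Eq324RowSuppliers ∕ Row ∕ RowCore ∕ RowCoreZero ∕
RowSchema ∕ RowRange ∕ RowRangeZero` to the DAG node's closer).  `bears_on: R4∕N08`; filed `--supports stmt-QuantumFields-20542` (K1⁷).  THEOREMS ONLY
(def-free, sorry-free, standard axioms); T4 and the lane consumed BY NAME.

WHAT IS PROVED (over `𝔄 : ∀ S, AlphaDataLT 𝔊 𝔠 (X S) (𝔖 S)` and `hα : ∀ S, S.g²·S.ε₀ ≤ (min γ₀ 1)² → RunAlphaEq324CoreLT 𝔊 𝔠 (X S) (𝔖 S) (𝔄 S)`):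
* §0 `nonempty_concreteLeaves_of_coreLT_le` ∕ `…_of_coreLT` — the constructed tower of a family member carries the concrete leaf bundle (T4 §0, via
  `…RowRange.runResiduals_of_alphaEq324CoreLT(_le)`).
* §1 `b10Compact_constructedLE_of_concreteLeaves` ∕ ★ `b10_main_constructedLE_upC_of_concreteLeaves` — T4's two closers with the inlined bundle construction
  ABSTRACTED into «every member carries a concrete leaf bundle» (`Nonempty (ConcreteLeaves …)` per member of `ScalesLE L γ`), so that the lane's clause and all
  edited clauses feed the same closer; ★ `b10_main_of_coreLT_upC` — `Dag.B10_main (leavesP w P) ∧ b10Compact (…)` at the C-binding of record over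
  `ScalesLE L ((min γ₀ 1)²)` from the range-honest core clause (in-edges unused).
So along the N08 count path the (α) clause may be read, end to end, with the [B1] (3.24) input AS PRINTED, without the Gaussian-regularity rows, with the
G3D-07∕08 bundle on the run's steps only — a 22-row step list whose data bundle is inhabitable for every record (`…RowRangeZero`).  HONEST FRAMING: count-neutral
kernel bookkeeping BY NAME; N08 NOT discharged (the rows ARE the cluster expansion = object gap; a pin displaying them ⇒ «discharged MODULO (α)», chair R434);
one finite 𝕋⁴ programme at fixed ε, d = 3 tori inside the record; nothing continuum ∕ OS ∕ mass gap ∕ Clay — R4 closes the conditional finite-𝕋⁴ rung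
`BalabanLadder.UV` only.
-/

namespace Summit.QuantumFields.YangMills.Theorems.BalabanUVNodesN08ConstructedCoreLT

open Literature.MathematicalPhysics.QuantumFieldTheory.Balaban1983to89
open Literature.MathematicalPhysics.QuantumFieldTheory.Balaban1983to89.DagBinding
open Literature.MathematicalPhysics.QuantumFieldTheory.Balaban1983to89.DagDischargedII
open Literature.MathematicalPhysics.QuantumFieldTheory.Balaban1983to89.B10 (TowerRun Thm1Printed Thm2Printed Thm1PrintedCompact)
open Literature.MathematicalPhysics.QuantumFieldTheory.Balaban1983to89.DagDischarged (b10Compact)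
open Literature.MathematicalPhysics.QuantumFieldTheory.Balaban1983to89.B10CompactBinding (ofPrintedAllXPNC)
open Literature.MathematicalPhysics.QuantumFieldTheory.Balaban1985CMP102.Setting
open Literature.MathematicalPhysics.QuantumFieldTheory.Balaban1985CMP102.Theorems (Family runs)
open Summit.QuantumFields.Balaban3D.Carriers
open Summit.QuantumFields.Balaban3D.Proofs.Constants (eps0Of)
open Summit.QuantumFields.Balaban3D.Proofs.UVStability3D (ConcreteLeaves leafSystem_of_concrete)
open Summit.QuantumFields.Balaban3D.Proofs.EndTheorem (carrierEqs_pin)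
open Summit.QuantumFields.Balaban3D.Proofs.Inputs (towerOf usesConsts_inputOf)
open Summit.QuantumFields.Balaban3D.Proofs.Residuals (analyticLeavesOf)
open Summit.QuantumFields.Balaban3D.Proofs.Primitives (AlphaConsts)
open Summit.QuantumFields.Balaban3D.Proofs.GroupModelLieC (lieC)
open Summit.QuantumFields.Balaban3D.Proofs.UVStability3DInputs
open Summit.QuantumFields.Balaban3D.Proofs.FamilyLE (ScalesLE le_of_eps0Of)
open Summit.QuantumFields.YangMills.Theorems.BalabanUVNodesN08AlphaEq324RowRange

variable {L : ℕ} {G : Type} [GaugeGroup G] [MeasurableSpace G] [HaarData G] {𝔊 : GroupModel G} {𝔠 : AlphaConsts L 𝔊.N}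
  {X : ∀ S : Scales L, ExternalInputs S G}
  {𝔖 : ∀ (S : Scales L) (k : ℕ), StepSeries S G ↥(lieC 𝔊) (nblkOf S 𝔠.lane.carrier k) k}
  {𝔄 : ∀ S : Scales L, AlphaDataLT 𝔊 𝔠 (X S) (𝔖 S)}
  {Xc : PrintedCarriersR} {Y : PrintedCarriers9X} {Z : PrintedCarriers11} {V : PrintedCarriers14R} {W : PrintedCarriers15}
  {w : WorldP} {P : B12.RunParams}

/-! ## §0 The constructed towers carry concrete leaf bundles as soon as the range-honest core clause holds -/

/-- **THE CONSTRUCTED TOWER CARRIES THE CONCRETE LEAF BUNDLE, given the range-honest core clause** on the `≤`-family (T4's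
`nonempty_concreteLeaves_constructedLE` with `RunAlpha ↦ RunAlphaEq324CoreLT`). [cite: Balaban1985UV3, pp.256–274 + Thm 1 p.257 + Thm 2 p.272] -/
theorem nonempty_concreteLeaves_of_coreLT_le (S : Scales L) (hle : S.g ^ 2 * S.ε₀ ≤ (min 𝔠.gamma0 1) ^ 2)
    (R : RunAlphaEq324CoreLT 𝔊 𝔠 (X S) (𝔖 S) (𝔄 S)) : Nonempty (ConcreteLeaves 𝔠.lane.consts S (towerOf 𝔠.lane (X S) (𝔖 S))) :=
  ⟨{ toCarrierEqs := carrierEqs_pin _ (usesConsts_inputOf 𝔠.lane (X S) (𝔖 S) fun _ => True)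
     toAnalyticLeaves := analyticLeavesOf (runResiduals_of_alphaEq324CoreLT_le hle R) }⟩

/-- The same on the spine's exhibited family `S.ε₀ = ε₀(S.g)`. [cite: Balaban1985UV3, pp.256–274 + p.256 L15–18] -/
theorem nonempty_concreteLeaves_of_coreLT (S : Scales L) (hS : S.ε₀ = eps0Of 𝔠.gamma0 S.g)
    (R : RunAlphaEq324CoreLT 𝔊 𝔠 (X S) (𝔖 S) (𝔄 S)) : Nonempty (ConcreteLeaves 𝔠.lane.consts S (towerOf 𝔠.lane (X S) (𝔖 S))) :=
  ⟨{ toCarrierEqs := carrierEqs_pin _ (usesConsts_inputOf 𝔠.lane (X S) (𝔖 S) fun _ => True)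
     toAnalyticLeaves := analyticLeavesOf (runResiduals_of_alphaEq324CoreLT hS R) }⟩

/-! ## §1 The COMPACT node at the C-binding of record over the constructed run family, from ANY family of concrete leaf bundles -/

section Leaves

variable {γ : ℝ} (hCL : ∀ S : ScalesLE L γ, Nonempty (ConcreteLeaves 𝔠.lane.consts S.1 (towerOf 𝔠.lane (X S.1) (𝔖 S.1))))
include hCL

/-- **THEOREM 1 (compact reading) ∧ THEOREM 2 FOR THE CONSTRUCTED DENSITIES = THE C-BINDING'S LEAF, FROM CONCRETE LEAF BUNDLES** on a `≤`-family
`ScalesLE L γ`: T4's `b10Compact_constructedLE` with its inlined bundle construction ABSTRACTED into the hypothesis «every member's constructed tower carries a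
concrete leaf bundle» — so that ANY (α)-type clause delivering such bundles (the lane's `RunAlpha` via `FamilyLE.runResiduals_of_alpha_le`, or the
source-faithful ∕ core ∕ range-honest clauses via `nonempty_concreteLeaves_of_coreLT_le` above) feeds the SAME closer.
[cite: Balaban1985UV3, Thm 1 p.257 (compact reading) + Thm 2 p.272] -/
theorem b10Compact_constructedLE_of_concreteLeaves (Xc : PrintedCarriersR) :
    b10Compact (Xc.withTowerRuns10 fun S : ScalesLE L γ => towerOf 𝔠.lane (X S.1) (𝔖 S.1)).toPrintedCarriers :=
  DagDischarged.b10Compact_withTowerRuns10_of_leafSystems Xc _ fun S =>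
    leafSystem_of_concrete 𝔠.lane.normalised (Classical.choice (hCL S))

/-- ★ **N08 BY NAME AT THE C-BINDING OF RECORD OVER THE CONSTRUCTED RUN FAMILY, FROM CONCRETE LEAF BUNDLES**: if `w.up P = ofPrintedAllXPNC
(Xc.withTowerRuns10 (S ↦ towerOf 𝔠.lane (X S) (𝔖 S))) Y Z V W` over `ScalesLE L γ` and every member's constructed tower carries a concrete leaf bundle, then
`Dag.B10_main (leavesP w P)` (in-edges unused) — T4's `b10_main_constructedLE_upC` with the bundle hypothesis abstracted; with `hCL :=
nonempty_concreteLeaves_of_coreLT_le` this is N08 by name from the RANGE-HONEST CORE (α) CLAUSE `RunAlphaEq324CoreLT`.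
[cite: Balaban1985UV3, Thm 1 p.257 (compact reading) + Thm 2 p.272] -/
theorem b10_main_constructedLE_upC_of_concreteLeaves
    (hup : w.up P = ofPrintedAllXPNC (Xc.withTowerRuns10 fun S : ScalesLE L γ => towerOf 𝔠.lane (X S.1) (𝔖 S.1)) Y Z V W) :
    Dag.B10_main (leavesP w P) :=
  B10CompactBinding.b10_main_of_upC (fun S : ScalesLE L γ => leafSystem_of_concrete 𝔠.lane.normalised (Classical.choice (hCL S))) hup

end Leaves

/-- ★ **N08 BY NAME AT THE C-BINDING OF RECORD FROM THE RANGE-HONEST CORE (α) CLAUSE** on `ScalesLE L ((min γ₀ 1)²)`: `b10_main_constructedLE_upC_of_concreteLeaves`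
with the bundles of `nonempty_concreteLeaves_of_coreLT_le`. [cite: Balaban1985UV3, Thm 1 p.257 (compact reading) + Thm 2 p.272] -/
theorem b10_main_of_coreLT_upC
    (hα : ∀ S : Scales L, S.g ^ 2 * S.ε₀ ≤ (min 𝔠.gamma0 1) ^ 2 → RunAlphaEq324CoreLT 𝔊 𝔠 (X S) (𝔖 S) (𝔄 S))
    (hup : w.up P = ofPrintedAllXPNC (Xc.withTowerRuns10 fun S : ScalesLE L ((min 𝔠.gamma0 1) ^ 2) =>
      towerOf 𝔠.lane (X S.1) (𝔖 S.1)) Y Z V W) :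
    Dag.B10_main (leavesP w P) ∧
      b10Compact (Xc.withTowerRuns10 fun S : ScalesLE L ((min 𝔠.gamma0 1) ^ 2) => towerOf 𝔠.lane (X S.1) (𝔖 S.1)).toPrintedCarriers :=
  ⟨b10_main_constructedLE_upC_of_concreteLeaves (fun S => nonempty_concreteLeaves_of_coreLT_le S.1 S.2 (hα S.1 S.2)) hup,
    b10Compact_constructedLE_of_concreteLeaves (fun S => nonempty_concreteLeaves_of_coreLT_le S.1 S.2 (hα S.1 S.2)) Xc⟩

end Summit.QuantumFields.YangMills.Theorems.BalabanUVNodesN08ConstructedCoreLT
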